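import Summits.ResolutionOfSingularities.ResolutionOfSingularities.Theorems.MarkedTransferCampaignW46ThreefoldsTauTwoSliceFiniteType
import Summits.ResolutionOfSingularities.ResolutionOfSingularities.Theorems.MarkedTransferCampaignW46ThreefoldsNoNearPointSlice
import HarnessLib

/-!
# [OURS · L1 W4.6 rung (ii-τ2)] THE `τ ≥ 2` LOCUS SLICE AT d = 3 — order-`m` locus = a regular equimultiple CURVE with `τ ≥ 2`
# plus finitely many isolated threefold POINTS with `τ ≥ 2`: order-reducible, PROVED (the curve blown up once, each point by
# its own terminating chain of point blow-ups, patched)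

Cell res-hironaka, LADDER-RESOLUTION rung L (D-0089), slot W4.6, rung (ii) (threefold hypersurfaces); seat res-L1-s46-pv-3
(gen 4). Host route MarkedTransfer, host item `HypersurfaceOrderReductionDimLeThree` (stmt-ResolutionOfSingularities-16156);
filed `--kind proof --supports` it `--as helper`. CONSOLIDATION of the campaign's two `τ ≥ 2` slices — the curve case
(`orderReducible_of_curve_two_le_tau`, p510009: Cossart–Piltant 2008 Lemma 4.3 (2), no near points over an equimultiple regular
curve with `τ ≥ 2`) and the isolated-point case (`orderReducible_comap_of_isolated_two_le_tau`, p515229: the terminating `τ = 2`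
chain) — through the campaign's finite patching (`OrderReducible.of_opens_finite`, p508549). OURS scheme theory over PROVED
tree lemmas; nothing of H. Hironaka's manuscript is asserted. AI-written; AI review is weaker than expert review.

## What is proved (no definitions)

* `CampaignW46.orderReducible_comap_of_curve_two_le_tau` — the curve slice RELATIVE TO AN OPEN `V`: a regular curve `Y ⊆ V`
  (embedding codimension `2` at its points, `ord = m`, `τ ≥ 2` along it) carrying all points of order `≥ m` INSIDE `V` ⟹
  `(V, J|_V, m)` order-reducible (blow `Y` up in `X`, read the result over `V`: end game `OrderReducible.comap_opens_of_seq`).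
* `CampaignW46.orderReducible_of_two_le_tau_locus` — **THE `τ ≥ 2` LOCUS SLICE**: `X` regular locally Noetherian, `m ≥ 1`; the
  points of order `≥ m` lie in `Y ∪ S`, `Y` a closed regular curve (codim-`2` part of a regular system of parameters at each
  point) with `ord = m` and `τ ≥ 2` along it, `S` a finite set of closed points off `Y` with `ord = m`, embedding dimension `3`,
  `τ ≥ 2` and G-ring local rings ⟹ `OrderReducible J m`.
* `CampaignW46.orderReducible_of_two_le_tau_locus_of_locallyOfFiniteType` — the same for `X` locally of finite type over a
  field, G-ring hypothesis discharged (p516287's source, Matsumura Cor. 32.6).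
* `CampaignW46.gammaFreeGlobalDimLE_two_le_tau_locus_slice (p d)` — in the binders of the ladder `GammaFreeGlobalOrderReductionDimLE`.

HONEST VALUE. For a threefold hypersurface input with `m` = its maximal order this is the COMPLETE «every point of the
order-`m` locus has `τ ≥ 2` and the one-dimensional part of that locus is a regular curve» case of Cossart–Piltant's Prop. 4.4
— characteristic-free and unconditional for schemes of finite type over a field. Outside: `τ = 1` points (polygon invariants),
singular or non-equimultiple curve components of the locus (CP2008 first makes `Σ` regular by point blow-ups — not here).

References: `…ThreefoldsNoNearPointSlice.lean` (p510009), `…ThreefoldsTauTwoSlice.lean` (p515229), `…ThreefoldsTauTwoSliceFiniteType.lean`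
(p516287), `…GammaFreeGlobalPatchingFinite.lean` (p508549 `OrderReducible.of_opens_finite` [Piltant2013, Prop. 5.1]); tree
`Resolution/NearPointsCurveCentre.lean` (`IsBlowup.idealOrder_controlledTransform_lt_of_two_le_stalkTau` [CossartPiltant2008,
Lemma 4.3 (2)]), `NearChainTermination.lean` [CossartPiltant2008, proof of Prop. 4.4]. H. Hironaka, ms. 2017-03-23 — scope only,
under adjudication, not cited as fact. [Hironaka2017]
-/

noncomputable section

set_option linter.dupNamespace false -- mandated namespace of this single-conjunct summit

open CategoryTheory AlgebraicGeometry TopologicalSpace IsLocalRing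

namespace Summit.ResolutionOfSingularities.ResolutionOfSingularities.Theorems

namespace CampaignW46

open Literature.AlgebraicGeometry.Resolution
open Scheme.IdealSheafData

universe u

variable {X : Scheme.{u}}

/-! ## §1 The curve slice relative to an open -/

/-- **THE CURVE SLICE RELATIVE TO AN OPEN.** `X` regular locally Noetherian, `V ⊆ X` open, `Y ⊆ V` a closed regular curve of
`X` — at each of its points `(𝓘_Y)_y` is generated by a part `(c₁, c₂)` of a regular system of parameters — with `ord_y J = m`
and `τ_y(J, m) ≥ 2` along it, `m ≥ 1`, such that every point of order `≥ m` lies on `Y` or outside `V`. Then `(V, J|_V, m)` is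
order-reducible: blow `Y` up in `X`; over `Y` the order drops (Cossart–Piltant 2008 Lemma 4.3 (2)), elsewhere it is unchanged,
so every point of the transform of order `≥ m` maps outside `V`. [cite: CossartPiltant2008, Lemma 4.3 (2)] -/
theorem orderReducible_comap_of_curve_two_le_tau [IsLocallyNoetherian X] (hX : Scheme.IsRegular X) (J : X.IdealSheafData)
    {m : ℕ} (hm : 1 ≤ m) (V : X.Opens) (Y : Closeds X) (hreg : Scheme.IsRegular (vanishingIdeal Y).subscheme)
    (hJY : ∀ x : X, (m : ℕ∞) ≤ idealOrder J x → x ∈ (Y : Set X) ∨ x ∉ (V : Set X))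
    (hord : ∀ y ∈ (Y : Set X), idealOrder J y = m)
    (hcurve : ∀ y ∈ (Y : Set X), haveI := hX y; ∃ c : Fin 2 → X.presheaf.stalk y, IsRsopPart c ∧
      Ideal.span (Set.range c) = stalkIdeal (vanishingIdeal Y) y ∧ 2 ≤ stalkTau J y m) :
    OrderReducible (J.comap V.ι) m := by
  have hD : ∀ y ∈ (Y : Set X), (m : ℕ∞) ≤ idealOrder J y := fun y hy => (hord y hy).ge
  obtain ⟨X', π, hπ⟩ := exists_isBlowup X (vanishingIdeal Y)
  haveI : IsProper π := hπ.isProper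
  haveI : IsLocallyNoetherian X' := LocallyOfFiniteType.isLocallyNoetherian π
  refine OrderReducible.comap_opens_of_seq (IsPermissibleBlowupSeq.single Y π hreg hD hπ) V fun x' hx' => ?_
  by_cases hmem : π x' ∈ ((vanishingIdeal Y).support : Set X)
  · -- over the curve the order drops: no such point
    exfalso
    rw [Scheme.IdealSheafData.coe_support_vanishingIdeal] at hmem
    haveI := hX (π x')
    obtain ⟨c, hcr, hcY, hτ2⟩ := hcurve (π x') hmem
    exact absurd hx' (not_le.mpr (hπ.idealOrder_controlledTransform_lt_of_two_le_stalkTau hX hreg hm hord hcr hcY hτ2))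
  · rw [hπ.idealOrder_controlledTransform_of_not_mem J m hmem] at hx'
    rcases hJY _ hx' with h | h
    · exfalso
      apply hmem
      rw [Scheme.IdealSheafData.coe_support_vanishingIdeal]
      exact h
    · exact h

/-! ## §2 The `τ ≥ 2` locus slice -/

set_option maxHeartbeats 400000 in
-- the bookkeeping of `n + 1` patching pieces
/-- **THE `τ ≥ 2` LOCUS SLICE.** `X` regular locally Noetherian, `J` an ideal sheaf, `m ≥ 1`. Suppose the points of order
`≥ m` lie in `Y ∪ S` where `Y` is a closed regular curve (codimension-`2` part of a regular system of parameters at each of its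
points) with `ord = m` and `τ ≥ 2` along it, and `S` is a finite set of closed points OFF `Y`, at each of which `ord = m`, the
embedding dimension is `3`, `τ ≥ 2`, and the local ring is a G-ring. Then `(X, J, m)` is ORDER-REDUCIBLE: the pieces
`(X ∖ S, Y)` and `(X ∖ (Y ∪ (S ∖ {x})), {x})`, `x ∈ S`, are order-reducible (`orderReducible_comap_of_curve_two_le_tau`,
`orderReducible_comap_of_isolated_two_le_tau`) and patch (`OrderReducible.of_opens_finite`).
[cite: CossartPiltant2008, Prop. 4.4 (proof); Piltant2013, Prop. 5.1] -/
theorem orderReducible_of_two_le_tau_locus [IsLocallyNoetherian X] (hX : Scheme.IsRegular X) (J : X.IdealSheafData)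
    {m : ℕ} (hm : 1 ≤ m) (Y : Closeds X) (hreg : Scheme.IsRegular (vanishingIdeal Y).subscheme)
    (hord : ∀ y ∈ (Y : Set X), idealOrder J y = m)
    (hcurve : ∀ y ∈ (Y : Set X), haveI := hX y; ∃ c : Fin 2 → X.presheaf.stalk y, IsRsopPart c ∧
      Ideal.span (Set.range c) = stalkIdeal (vanishingIdeal Y) y ∧ 2 ≤ stalkTau J y m)
    (S : Set X) (hS : S.Finite) (hSc : ∀ x ∈ S, IsClosed ({x} : Set X)) (hSY : Disjoint S (Y : Set X))
    (hordS : ∀ x ∈ S, idealOrder J x = m) (hdim : ∀ x ∈ S, (maximalIdeal (X.presheaf.stalk x)).spanFinrank = 3)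
    (hτ : ∀ x ∈ S, haveI := hX x; 2 ≤ stalkTau J x m) (hG : ∀ x ∈ S, IsGRing (X.presheaf.stalk x))
    (hJ : ∀ x : X, (m : ℕ∞) ≤ idealOrder J x → x ∈ (Y : Set X) ∨ x ∈ S) : OrderReducible J m := by
  classical
  obtain ⟨n, f, hf⟩ := hS.fin_embedding
  have hfS : ∀ i, f i ∈ S := fun i => hf ▸ Set.mem_range_self i
  have hSf : ∀ x ∈ S, ∃ i, f i = x := fun x hx => by rw [← hf] at hx; exact hx
  -- the closed pieces
  have hScl : IsClosed S := isClosed_of_finite_of_isClosed_singleton hS hSc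
  have hSicl : ∀ i, IsClosed (S \ {f i}) := fun i =>
    isClosed_of_finite_of_isClosed_singleton (hS.subset Set.sdiff_subset) fun y hy => hSc y hy.1
  let V : Fin (n + 1) → X.Opens := Fin.cases ⟨Sᶜ, hScl.isOpen_compl⟩
    fun i => ⟨((Y : Set X) ∪ (S \ {f i}))ᶜ, (Y.2.union (hSicl i)).isOpen_compl⟩
  let Z : Fin (n + 1) → Set X := Fin.cases (Y : Set X) fun i => {f i}
  have hV0 : (V 0 : Set X) = Sᶜ := rfl
  have hVs : ∀ i : Fin n, (V i.succ : Set X) = ((Y : Set X) ∪ (S \ {f i}))ᶜ := fun i => rfl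
  have hZ0 : Z 0 = (Y : Set X) := rfl
  have hZs : ∀ i : Fin n, Z i.succ = {f i} := fun i => rfl
  refine OrderReducible.of_opens_finite (n + 1) hX J m V Z (fun i => ?_) (fun i => ?_) (fun i j hij => ?_)
    (fun x hx => ?_) (fun i => ?_)
  · -- closed pieces
    refine Fin.cases ?_ (fun i => ?_) i
    · rw [hZ0]; exact Y.2
    · rw [hZs]; exact hSc _ (hfS i)
  · -- `Z i ⊆ V i`
    refine Fin.cases ?_ (fun i => ?_) i
    · rw [hZ0, hV0]
      exact Set.subset_compl_iff_disjoint_left.mpr hSY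
    · rw [hZs, hVs, Set.singleton_subset_iff, Set.mem_compl_iff, Set.mem_union, not_or]
      exact ⟨fun h => Set.disjoint_left.mp hSY (hfS i) h, fun h => h.2 rfl⟩
  · -- `Z i ∩ V j = ∅` for `i ≠ j`
    revert hij
    refine Fin.cases ?_ (fun i' => ?_) i <;> refine Fin.cases ?_ (fun j' => ?_) j <;> intro hij
    · exact absurd rfl hij
    · rw [hZ0, hVs]
      exact Set.disjoint_left.mpr fun y hy hyV => hyV (Or.inl hy)
    · rw [hZs, hV0]
      exact Set.disjoint_left.mpr fun y hy hyV => hyV (by rw [Set.mem_singleton_iff.mp hy]; exact hfS i')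
    · rw [hZs, hVs]
      refine Set.disjoint_left.mpr fun y hy hyV => hyV (Or.inr ⟨?_, ?_⟩)
      · rw [Set.mem_singleton_iff.mp hy]; exact hfS i'
      · rw [Set.mem_singleton_iff.mp hy, Set.mem_singleton_iff]
        exact fun h => hij (by rw [f.injective h])
  · -- the pieces carry the order-`≥ m` locus
    rcases hJ x hx with h | h
    · exact ⟨0, by rw [hZ0]; exact h⟩
    · obtain ⟨i, rfl⟩ := hSf x h
      exact ⟨i.succ, by rw [hZs]; exact Set.mem_singleton _⟩
  · -- each piece is order-reducible
    refine Fin.cases ?_ (fun i => ?_) i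
    · refine orderReducible_comap_of_curve_two_le_tau hX J hm (V 0) Y hreg (fun x hx => ?_) hord hcurve
      rcases hJ x hx with h | h
      · exact Or.inl h
      · exact Or.inr (by rw [hV0]; exact fun h' => h' h)
    · refine orderReducible_comap_of_isolated_two_le_tau hX J hm (V i.succ) (f i) ?_ (hSc _ (hfS i)) (fun z hz => ?_)
        (hordS _ (hfS i)) (hdim _ (hfS i)) (hτ _ (hfS i)) (hG _ (hfS i))
      · change f i ∈ (V i.succ : Set X)
        rw [hVs, Set.mem_compl_iff, Set.mem_union, not_or]
        exact ⟨fun h => Set.disjoint_left.mp hSY (hfS i) h, fun h => h.2 rfl⟩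
      · by_cases hzi : z = f i
        · exact Or.inl hzi
        · right
          rw [hVs, Set.mem_compl_iff, not_not]
          rcases hJ z hz with h | h
          · exact Or.inl h
          · exact Or.inr ⟨h, hzi⟩

/-! ## §3 Finite type over a field; the ladder's binders -/

/-- The `τ ≥ 2` locus slice for `X` regular and locally of finite type over a field: NO G-ring hypothesis.
[cite: CossartPiltant2008, Prop. 4.4; Matsumura1987, §32] -/
theorem orderReducible_of_two_le_tau_locus_of_locallyOfFiniteType {k : Type u} [Field k] (s : X ⟶ Spec (.of k))
    [LocallyOfFiniteType s] (hX : Scheme.IsRegular X) (J : X.IdealSheafData) {m : ℕ} (hm : 1 ≤ m) (Y : Closeds X)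
    (hreg : Scheme.IsRegular (vanishingIdeal Y).subscheme) (hord : ∀ y ∈ (Y : Set X), idealOrder J y = m)
    (hcurve : ∀ y ∈ (Y : Set X), haveI := hX y; ∃ c : Fin 2 → X.presheaf.stalk y, IsRsopPart c ∧
      Ideal.span (Set.range c) = stalkIdeal (vanishingIdeal Y) y ∧ 2 ≤ stalkTau J y m)
    (S : Set X) (hS : S.Finite) (hSc : ∀ x ∈ S, IsClosed ({x} : Set X)) (hSY : Disjoint S (Y : Set X))
    (hordS : ∀ x ∈ S, idealOrder J x = m) (hdim : ∀ x ∈ S, (maximalIdeal (X.presheaf.stalk x)).spanFinrank = 3)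
    (hτ : ∀ x ∈ S, haveI := hX x; 2 ≤ stalkTau J x m)
    (hJ : ∀ x : X, (m : ℕ∞) ≤ idealOrder J x → x ∈ (Y : Set X) ∨ x ∈ S) : OrderReducible J m := by
  haveI : IsLocallyNoetherian X := LocallyOfFiniteType.isLocallyNoetherian s
  exact orderReducible_of_two_le_tau_locus hX J hm Y hreg hord hcurve S hS hSc hSY hordS hdim hτ
    (fun x _ => isGRing_stalk_of_polynomial Matsumura1987_32_polynomial_holds s x) hJ

/-- **THE `τ ≥ 2` LOCUS SLICE OF EVERY RUNG OF THE Γ-FREE LADDER** (`GammaFreeGlobalOrderReductionDimLE p d`, p496755): its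
binders, plus «the points of order `≥ m` lie on a closed regular equimultiple curve with `τ ≥ 2` or in a finite set of closed
threefold points with `ord = m` and `τ ≥ 2` off the curve» ⇒ `OrderReducible I m`, unconditionally.
[cite: CossartPiltant2008, Prop. 4.4; Matsumura1987, §32] -/
theorem gammaFreeGlobalDimLE_two_le_tau_locus_slice (p d : ℕ) :
    p.Prime → ∀ (k : Type u) [Field k] [CharP k p] [PerfectField k] (X : Scheme.{u}) (s : X ⟶ Spec (.of k)),
      IsSeparated s → LocallyOfFiniteType s → QuasiCompact s → IsIntegral X → ∀ (hreg : Scheme.IsRegular X),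
        topologicalKrullDim X ≤ d → ∀ (I : X.IdealSheafData), I ≠ ⊥ → IsEffectiveCartier I → ∀ (m : ℕ), 1 ≤ m →
          ∀ (Y : Closeds X), Scheme.IsRegular (vanishingIdeal Y).subscheme → (∀ y ∈ (Y : Set X), idealOrder I y = m) →
            (∀ y ∈ (Y : Set X), haveI := hreg y; ∃ c : Fin 2 → X.presheaf.stalk y, IsRsopPart c ∧
              Ideal.span (Set.range c) = stalkIdeal (vanishingIdeal Y) y ∧ 2 ≤ stalkTau I y m) →
            ∀ (S : Set X), S.Finite → (∀ x ∈ S, IsClosed ({x} : Set X)) → Disjoint S (Y : Set X) →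
              (∀ x ∈ S, idealOrder I x = m) → (∀ x ∈ S, (maximalIdeal (X.presheaf.stalk x)).spanFinrank = 3) →
                (∀ x ∈ S, haveI := hreg x; 2 ≤ stalkTau I x m) →
                  (∀ x : X, (m : ℕ∞) ≤ idealOrder I x → x ∈ (Y : Set X) ∨ x ∈ S) → OrderReducible I m := by
  intro _ k _ _ _ X s _ hloft _ _ hreg _ I _ _ m hm Y hYreg hord hcurve S hS hSc hSY hordS hdim hτ hJ
  exact orderReducible_of_two_le_tau_locus_of_locallyOfFiniteType s hreg I hm Y hYreg hord hcurve S hS hSc hSY hordS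
    hdim hτ hJ

end CampaignW46

end Summit.ResolutionOfSingularities.ResolutionOfSingularities.Theorems

end
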